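import Literature.MathematicalPhysics.QuantumManyBody.TorusFockLayer
import Literature.MathematicalPhysics.QuantumManyBody.PeriodicBoseGasImpurityTranslation
import Literature.MathematicalPhysics.QuantumManyBody.PeriodicCondensateCoherence

/-!
# Torus-translation covariance of cell occupations (route `BlockLatticeFSum`; decomp-a2c lens-6 g22)

For a periodic trial state `Φ`, its translate `Ψ = τ_t Φ` (`Ψ(X) = Φ(X − (t,…,t))`,
`PeriodicTrialState.exists_translate`) and an `Lℤ³`-PERIODIC one-body mode `φ`:
`n_φ(τ_t Φ) = n_(φ(· + t))(Φ)` (`cellOccupation_translate`). Tools: the mode amplitude `modeAn`,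
`setIntegral_cell_comp_add_of_periodic` (first particle) and `lintegral_cellN_comp_add` (the others).
No definitions, no `sorry`.
-/

namespace Summit.AtomisticToContinuum.BoseEinsteinCondensation.Theses.BlockLatticeFSum.Covariance

open MeasureTheory Complex
open scoped ENNReal NNReal ComplexConjugate BigOperators
open Literature.MathematicalPhysics.QuantumManyBody.BoseGas

variable {L : ℝ} {n : ℕ}

/-- Prepending commutes with adding to the first particle. -/
theorem vecCons_add_left (x e : Space) (Y : Config n) :
    (Matrix.vecCons (x + e) Y : Config (n + 1)) = Matrix.vecCons x Y + Pi.single (0 : Fin (n + 1)) e := by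
  funext j
  refine Fin.cases ?_ (fun k => ?_) j
  · simp
  · simp

/-- Translating all particles, seen through `vecCons`. -/
theorem vecCons_sub_const (x t : Space) (Y : Config n) :
    (Matrix.vecCons x Y : Config (n + 1)) - (fun _ => t) = Matrix.vecCons (x - t) (Y - fun _ => t) := by
  funext j
  refine Fin.cases ?_ (fun k => ?_) j
  · simp
  · simp

/-- The amplitude of a periodic mode is periodic in the spectator particles. -/
theorem modeAn_periodic (Φ : PeriodicTrialState (n + 1) L) (φ : Space → ℂ) (Y : Config n)
    (i : Fin n) (k : Fin 3) :
    modeAn L φ Φ.ψ (Y + Pi.single i (EuclideanSpace.single k L)) = modeAn L φ Φ.ψ Y := by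
  unfold modeAn
  congr 1
  refine setIntegral_congr_fun (measurableSet_cell L) fun x _ => ?_
  -- prepending commutes with adding to one of the other particles (the tree's `SwapToZeroMode.vecCons_add_single_right`
  -- lives in a module that does not build on the farm at present, so the two-line computation is inlined)
  have hv : (Matrix.vecCons x (Y + Pi.single i (EuclideanSpace.single k L)) : Config (n + 1))
      = Matrix.vecCons x Y + Pi.single i.succ (EuclideanSpace.single k L) := by
    funext j
    refine Fin.cases ?_ (fun k' => ?_) j
    · simp
    · by_cases h : k' = i
      · subst h; simp
      · simp [Pi.single_eq_of_ne h, Pi.single_eq_of_ne (fun hk => h (Fin.succ_injective _ hk))]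
  rw [hv, Φ.periodic]

/-- **Pointwise covariance of the amplitude**:
`a(φ)(τ_t Φ)(Y) = a(φ(·+t))(Φ)(Y − (t,…,t))` for an `Lℤ³`-periodic mode `φ`. -/
theorem modeAn_translate (hL : 0 < L) (Φ : PeriodicTrialState (n + 1) L) (t : Space)
    {Ψ : PeriodicTrialState (n + 1) L} (hΨ : Ψ.ψ = fun X => Φ.ψ (X - fun _ => t))
    {φ : Space → ℂ} (hφper : ∀ (x : Space) (k : Fin 3), φ (x + EuclideanSpace.single k L) = φ x)
    (Y : Config n) :
    modeAn L φ Ψ.ψ Y = modeAn L (fun x => φ (x + t)) Φ.ψ (Y - fun _ => t) := by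
  unfold modeAn
  congr 1
  rw [hΨ]
  simp only [vecCons_sub_const]
  have hper : ∀ (x : Space) (k : Fin 3),
      conj (φ (x + EuclideanSpace.single k L + t)) * Φ.ψ (Matrix.vecCons (x + EuclideanSpace.single k L) (Y - fun _ => t))
        = conj (φ (x + t)) * Φ.ψ (Matrix.vecCons x (Y - fun _ => t)) := by
    intro x k
    rw [add_right_comm, hφper, vecCons_add_left, Φ.periodic]
  have key := setIntegral_cell_comp_add_of_periodic hL
    (H := fun x => conj (φ (x + t)) * Φ.ψ (Matrix.vecCons x (Y - fun _ => t))) hper (-t)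
  simp only [← sub_eq_add_neg, sub_add_cancel] at key
  exact key

/-- **COVARIANCE OF CELL OCCUPATIONS under torus translations**:
`n_φ(τ_t Φ) = n_(φ(·+t))(Φ)` for an `Lℤ³`-periodic mode `φ`. -/
theorem cellOccupation_translate (hL : 0 < L) (Φ : PeriodicTrialState (n + 1) L) (t : Space)
    {Ψ : PeriodicTrialState (n + 1) L} (hΨ : Ψ.ψ = fun X => Φ.ψ (X - fun _ => t))
    {φ : Space → ℂ} (hφper : ∀ (x : Space) (k : Fin 3), φ (x + EuclideanSpace.single k L) = φ x) :
    cellOccupation (n + 1) L φ Ψ.ψ = cellOccupation (n + 1) L (fun x => φ (x + t)) Φ.ψ := by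
  rw [cellOccupation_eq_lintegral_modeAn, cellOccupation_eq_lintegral_modeAn]
  simp_rw [modeAn_translate hL Φ t hΨ hφper]
  have hG : ∀ (Y : Config n) (i : Fin n) (k : Fin 3),
      (‖modeAn L (fun x => φ (x + t)) Φ.ψ (Y + Pi.single i (EuclideanSpace.single k L))‖₊ : ℝ≥0∞) ^ 2
        = (‖modeAn L (fun x => φ (x + t)) Φ.ψ Y‖₊ : ℝ≥0∞) ^ 2 := by
    intro Y i k
    rw [modeAn_periodic]
  have h := lintegral_cellN_comp_add (N := n) hL
    (G := fun Y => (‖modeAn L (fun x => φ (x + t)) Φ.ψ Y‖₊ : ℝ≥0∞) ^ 2) hG (-(fun _ => t))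
  simp only [← sub_eq_add_neg] at h
  exact h

end Summit.AtomisticToContinuum.BoseEinsteinCondensation.Theses.BlockLatticeFSum.Covariance
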